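import Literature.NumberTheory.Automorphic.NewformAdelisationArchSmooth
import Literature.NumberTheory.Automorphic.NewformAdelisationCasimir
import Literature.NumberTheory.Automorphic.GLnAdelicStructureProofs
import HarnessLib

/-!
# The adelic lift of a cusp form is `Z(𝔤)`-finite (Borel–Jacquet 4.2 (c) for `φ_f`), unconditionally

Topic `NumberTheory/Automorphic`; theorems only (no definition, no named fact; D-0026). Composition of
`NewformAdelisationArchSmooth` (`isArchSmooth_ofArch_adelicLiftFunA_cuspForm`: the adelic lift of a
cusp form is smooth in the archimedean variable of the `GL₂/ℚ` datum), `NewformAdelisationCasimir`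
(`X φ_f = 0`, Casimir and centre eigenvalues along `ι_𝔸`, under that smoothness hypothesis) and
`GL2ZFiniteOfEigenfunction` (`Rat.hasZCharacter_of_casimir_of_zed`, `Z(U(𝔤𝔩₂)) = ℂ[Z, C]`): for a
cusp form `f ∈ S_k(Γ₁(N))` and its adelic lift `φ_f = adelicLiftFunA N k f`,

* `lowerFun_adelicLiftFunA_eq_zero'` — `X φ_f = 0` along `ι_𝔸` (Gelbart 1997, (2.5.4) (v));
* `sum_lieDeriv_single_adelicLiftFunA'` — `C φ_f = (((k-1)/2)² + ((1-k)/2)² - ½) φ_f`;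
* `hasZCharacter_adelicLiftFunA`, `isZFinite_adelicLiftFunA` — **`φ_f` has a `Z(𝔤)`-character and is
  `Z(𝔤)`-finite** for the `GL₂/ℚ` automorphy datum (property (c) of Borel–Jacquet 1979, 4.2), with no
  hypothesis left (the datum is instantiated with the proved compactness
  `isCompact_glFiniteIntegralLevel_holds` where the statement does not mention it).

## References

* A. Borel, H. Jacquet, *Automorphic forms and automorphic representations*, Corvallis 1979,
  §1.6, 4.2 (c). [BorelJacquet1979]
* S. Gelbart, *Three lectures …* (1997), (2.5.4) (v), Remark 2.5.5. [Gelbart1997]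
* A. W. Knapp, *Lie Groups Beyond an Introduction* (2002), Thm. 5.44. [Knapp2002]
* D. Bump, *Automorphic Forms and Representations* (1997), §2.2. [Bump1997]
-/

noncomputable section

open scoped MatrixGroups Matrix Classical
open NumberField

namespace Literature.NumberTheory.Automorphic

-- Mathlib idiom (Mathlib/Algebra/Lie/OfAssociative.lean), as in `GL2WeightVectors`: Lie subalgebras of matrix algebras.
attribute [local instance 100] LieRing.ofAssociativeRing

open GL2Real

variable {N : ℕ} [NeZero N] {k : ℤ} (f : CuspForm (CongruenceSubgroup.Gamma1 N) k)

/-- **`X φ_f = 0` along `ι_𝔸`** for the adelic lift of a cusp form (Gelbart 1997, (2.5.4) (v)),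
unconditionally (`lowerFun_adelicLiftFunA_eq_zero` + `isArchSmooth_ofArch_adelicLiftFunA_cuspForm`,
the datum instantiated with `isCompact_glFiniteIntegralLevel_holds`). [cite: Gelbart1997, (2.5.4) (v)] -/
theorem lowerFun_adelicLiftFunA_eq_zero' : lowerFun Rat.iotaA (adelicLiftFunA N k f) = 0 :=
  lowerFun_adelicLiftFunA_eq_zero f
    (isArchSmooth_ofArch_adelicLiftFunA_cuspForm (hcpt := isCompact_glFiniteIntegralLevel_holds 2 ℚ) f)

/-- **`C φ_f = ∑_{a,b} E_{ab}E_{ba} φ_f = (((k-1)/2)² + ((1-k)/2)² - ½) φ_f` along `ι_𝔸`**,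
unconditionally. [cite: Knapp2002, Thm. 5.44] [cite: Bump1997, §2.2] -/
theorem sum_lieDeriv_single_adelicLiftFunA' :
    (∑ a : Fin 2, ∑ b : Fin 2, lieDeriv Rat.iotaA (toLie (Matrix.single a b (1 : ℝ)))
        (lieDeriv Rat.iotaA (toLie (Matrix.single b a (1 : ℝ))) (adelicLiftFunA N k f))) =
      (((((k : ℤ) : ℂ) - 1) / 2) ^ 2 + ((1 - ((k : ℤ) : ℂ)) / 2) ^ 2 - 1 / 2) • adelicLiftFunA N k f :=
  sum_lieDeriv_single_adelicLiftFunA f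
    (isArchSmooth_ofArch_adelicLiftFunA_cuspForm (hcpt := isCompact_glFiniteIntegralLevel_holds 2 ℚ) f)

variable {hcpt : isCompact_glFiniteIntegralLevel 2 ℚ}

/-- **`Z(𝔤)` acts on `φ_f` through a character** (`Rat.hasZCharacter_of_casimir_of_zed` with the
Casimir scalar of `sum_lieDeriv_single_adelicLiftFunA'` and `Z φ_f = 0 = ((k-1)/2 + (1-k)/2) φ_f`).
[cite: BorelJacquet1979, §1.6 and 4.2 (c)] [cite: Bump1997, §2.2] -/
theorem hasZCharacter_adelicLiftFunA :
    ∃ θ : centerU (AutomorphyDatum.gl 2 ℚ hcpt).arch →ₐ[ℝ] ℂ,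
      HasZCharacter (AutomorphyDatum.gl 2 ℚ hcpt).ofArch (adelicLiftFunA N k f) θ :=
  Rat.hasZCharacter_of_casimir_of_zed (isArchSmooth_ofArch_adelicLiftFunA_cuspForm f)
    (sum_lieDeriv_single_adelicLiftFunA' f)
    (by rw [lieDeriv_one_adelicLiftFunA, show (((k : ℤ) : ℂ) - 1) / 2 + (1 - ((k : ℤ) : ℂ)) / 2 = 0 by ring,
      zero_smul])

/-- **The adelic lift of a cusp form is `Z(𝔤)`-finite** — property (c) of an automorphic form
(Borel–Jacquet 1979, 4.2) for `φ_f` and the `GL₂/ℚ` automorphy datum, with no hypothesis.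
[cite: BorelJacquet1979, 4.2 (c)] -/
theorem isZFinite_adelicLiftFunA :
    IsZFinite (AutomorphyDatum.gl 2 ℚ hcpt).ofArch (adelicLiftFunA N k f) := by
  obtain ⟨θ, hθ⟩ := hasZCharacter_adelicLiftFunA (hcpt := hcpt) f
  exact IsZFinite.of_hasZCharacter hθ

end Literature.NumberTheory.Automorphic
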